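import Summits.Ventures.PercRepro.GenQCoreChain

/-!
# PercRepro — the flat-packing rows at every rank on the core (night-4, gen 7)

A `(f(r−1) + 1)`-subset of a rank-`r` flat's trace spans that flat, so distinct rank-`r` flats carry disjoint
families of such subsets: `Σ_{F ∈ flatsQ r} C(|F ∩ G|, f(r−1) + 1) ≤ C(|G|, f(r−1) + 1)`.  This is
`sum_flats_choose_k_le_gen` (GenQLargeGen) read at `q = r + 1`; on the core with the size chain
`fCore = 3, 3, 3, 6, 10, 21, 43, …` (GenQCoreChain) it gives the rows the exact-flow LP of sheet §62 (k8) uses: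
rank-`3` flats at `4`-subsets, solids at `7`-subsets, rank-`5` flats at `11`-subsets, hyperplanes of a rank-`7`
set at `22`-subsets.  Imports `GenQCoreChain`.
-/
namespace PercRepro.Night4

open Finset ThmH SixFour GenQ PerFlat Star NightThree

variable {α : Type} [DecidableEq α] {M : Matroid α} [M.Finite]

/-- **The flat-packing row at rank `r` on the core**: `Σ_{F ∈ flatsQ M r} C(|F ∩ G|, fCore (r − 1) + 1) ≤ C(|G|, fCore (r − 1) + 1)`
for `1 ≤ r` (`sum_flats_choose_k_le_gen` at `q = r + 1` with the core's size chain). -/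
theorem sum_flats_choose_fCore_le_of_core {p : ℕ} (hc : Core M p) (h10 : ∀ F ∈ flatsQ M 4, F.card ≤ 10)
    {r : ℕ} (hr : 1 ≤ r) {G : Finset α} (hG : G ⊆ gr M) :
    ∑ F ∈ flatsQ M r, (F ∩ G).card.choose (fCore (r - 1) + 1) ≤ G.card.choose (fCore (r - 1) + 1) := by
  have h := sum_flats_choose_k_le_gen (sizeChain_core hc h10 (r + 1)) (by omega) hG
  simpa using h

/-- The rank-`5` packing row: `Σ_{F ∈ flatsQ M 5} C(|F ∩ G|, 11) ≤ C(|G|, 11)` (two rank-`5` flats share at most a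
solid, `≤ 10` points). -/
theorem sum_flats_five_choose_eleven_le_of_core {p : ℕ} (hc : Core M p) (h10 : ∀ F ∈ flatsQ M 4, F.card ≤ 10)
    {G : Finset α} (hG : G ⊆ gr M) :
    ∑ F ∈ flatsQ M 5, (F ∩ G).card.choose 11 ≤ G.card.choose 11 := by
  have h := sum_flats_choose_fCore_le_of_core hc h10 (r := 5) (by norm_num) hG
  simpa [show fCore 4 = 10 from rfl] using h

/-- The solid packing row: `Σ_{F ∈ flatsQ M 4} C(|F ∩ G|, 7) ≤ C(|G|, 7)` (two solids share at most a plane, `≤ 6` points). -/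
theorem sum_flats_four_choose_seven_le_of_core {p : ℕ} (hc : Core M p) (h10 : ∀ F ∈ flatsQ M 4, F.card ≤ 10)
    {G : Finset α} (hG : G ⊆ gr M) :
    ∑ F ∈ flatsQ M 4, (F ∩ G).card.choose 7 ≤ G.card.choose 7 := by
  have h := sum_flats_choose_fCore_le_of_core hc h10 (r := 4) (by norm_num) hG
  simpa [show fCore 3 = 6 from rfl] using h

end PercRepro.Night4
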